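import Mathlib
import Summits.NavierStokesRegularity.NavierStokesRegularity.Theses.MonotoneCritical
import Literature.Analysis.FluidPDE.NSCriticalClosureHolds
import HarnessLib

/-!
# `MonotoneCritical.MonotoneCriticalL3Closure` — the `L³` continuation criterion
  (route `MonotoneCritical`, item stmt-NavierStokesRegularity-0063, support)

**Statement.** A classical Leray–Hopf solution from a rapidly decaying datum on `[0, T)` with
`sup_{0 ≤ t < T} ‖u(t)‖_{L³} < ∞` extends smoothly past `T` (Escauriaza–Seregin–Šverák 2003,
Thm. 1.4; Seregin 2012, Thm. 1.1).

PROOF. Verbatim the tree's UNCONDITIONAL discharge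
`Literature.Analysis.FluidPDE.hasSmoothExtensionPast_of_eLpNorm_three_bounded_holds` of the named
fact `hasSmoothExtensionPast_of_eLpNorm_three_bounded` (standard axioms).

HONEST FRAMING: a KNOWN continuation criterion; nothing here bears on the regularity problem beyond
what ESS 2003 already proves.
-/

noncomputable section

set_option linter.dupNamespace false

namespace Summit.NavierStokesRegularity.NavierStokesRegularity.Theorems

/-- **Item stmt-NavierStokesRegularity-0063** (`MonotoneCritical.MonotoneCriticalL3Closure`): the `L³`
continuation criterion. [EscauriazaSereginSverak2003 Thm 1.4; Seregin2012 Thm 1.1; tree: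
`hasSmoothExtensionPast_of_eLpNorm_three_bounded_holds`] -/
theorem monotoneCritical_monotoneCriticalL3Closure_proof :
    Summit.NavierStokesRegularity.NavierStokesRegularity.Theses.MonotoneCritical.MonotoneCriticalL3Closure := by
  unfold Summit.NavierStokesRegularity.NavierStokesRegularity.Theses.MonotoneCritical.MonotoneCriticalL3Closure
  exact Literature.Analysis.FluidPDE.hasSmoothExtensionPast_of_eLpNorm_three_bounded_holds

end Summit.NavierStokesRegularity.NavierStokesRegularity.Theorems

end
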